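import Mathlib
import Literature.AlgebraicGeometry.Resolution.AdicQuotient
import Summits.ResolutionOfSingularities.ResolutionOfSingularities.Theorems.TeissierJungTeissierResolveToricTargetPowerSeries
import HarnessLib

/-!
# `TeissierResolve`, line Sketch — stub `stub_supportedSeries_adicCompletion` (the completed
# simplicial toric ring is the ring of weight-`0`-supported power series)

Crux `stmt-ResolutionOfSingularities-17086`
(`Summit.ResolutionOfSingularities.ResolutionOfSingularities.Theses.TeissierJung.TeissierResolve`),
line "toric normalisation + destackification". This file proves the plumbing stub
`stub_supportedSeries_adicCompletion` of the lead skeleton (v8): the CONCRETE MODEL of the target of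
toric normalisation (normalised Teissier branches are completed simplicial toric rings
`AdicCompletion 𝔪₀ S₀`; the research stub of the line produces the normalisation as a subring
`R ⊆ k⟦y₁, …, y_{d'}⟧` of power series supported on weight-`0` monomials, and this file
identifies that subring with `AdicCompletion 𝔪₀ S₀`).

## Informal statement

Let `k` be a field, `A'` a finite abelian group, `deg : {1, …, d'} → A'` weights, and grade
`S = k[y₁, …, y_{d'}]` by `A'` through `deg` (Mathlib's `MvPolynomial.weightedHomogeneousSubmodule`,
a `GradedAlgebra` via the local instance `MvPolynomial.weightedGradedAlgebra`). Let `S₀ ⊆ S` be the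
degree-`0` part (the simplicial toric ring `k[σ^∨ ∩ M]` = the invariants of the diagonalizable
group `D(A')` acting on affine `d'`-space, Fulton §1.3, §2.1–2.2), `𝔪₀ = ker (constantCoeff|_{S₀})`
its irrelevant ideal, and `R ⊆ k⟦y₁, …, y_{d'}⟧` the subring of power series all of whose monomials
`y^m` have weight `Σᵢ mᵢ • deg i = 0`. Then `R ≃+* AdicCompletion 𝔪₀ S₀` (the `𝔪₀`-adic
completion of `S₀`, Atiyah–Macdonald Ch. 10).

## Proof

Put `D = d' |A'| + 1`. *Key lemma* (`mem_pow_of_coeff_eq_zero`): an element of `S₀` with no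
monomials of total degree `< n D` lies in `𝔪₀ ^ n`. Indeed it is a `k`-combination of weight-`0`
monomials of degree `≥ n D`, and such a monomial `y^m` lies in `𝔪₀ ^ n` (`monomial_mem_pow`,
induction on `n`): if `n ≥ 1` then `|m| ≥ D > d' |A'|`, so some exponent `m_j ≥ |A'|` and
`y^m = y^{m'} · y_j^{|A'|}` with `y_j^{|A'|} ∈ 𝔪₀` of weight `|A'| • deg j = 0`, whence `m'` has
weight `0` and degree `≥ n D - |A'| ≥ (n - 1) D`, so `y^{m'} ∈ 𝔪₀ ^ (n - 1)` by induction.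
Conversely `𝔪₀ ^ n ⊆ (y₁, …, y_{d'}) ^ n` has no monomials of degree `< n`
(`coeff_eq_zero_of_mem_pow`); so the `𝔪₀`-adic topology of `S₀` is induced by the `(y)`-adic
topology of `k[y]`.

The maps `R → S₀ ⧸ 𝔪₀ ^ n`, `f ↦ [trunc_{< n D} f]` (total-degree truncation; a truncation of a
weight-`0`-supported series lies in `S₀`) are ring homomorphisms (`exists_levelHom`: truncation
is multiplicative up to monomials of degree `≥ n D`, which die in `𝔪₀ ^ n` by the key lemma) and
compatible, so they lift to `Ψ : R → AdicCompletion 𝔪₀ S₀` (`AdicCompletion.liftRingHom`). `Ψ`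
is injective: if `Ψ f = 0` then `trunc_{< n D} f ∈ 𝔪₀ ^ n ⊆ (y) ^ n` kills all coefficients of
degree `< n`, for every `n`. `Ψ` is surjective: an element of the completion is the class of an
`𝔪₀`-adically Cauchy sequence `(c_n)` in `S₀`; since `c_m - c_n ∈ 𝔪₀ ^ m ⊆ (y) ^ m` for
`m ≤ n`, the coefficients of `c_n` of degree `< m` are eventually constant, with weight-`0`
support, so they define `g ∈ R`; and `trunc_{< n D} g ≡ c_{n D} ≡ c_n (mod 𝔪₀ ^ n)`, the first
congruence by the key lemma (the two sides have the same coefficients in degrees `< n D`), the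
second by the Cauchy condition. Hence `R ≃+* AdicCompletion 𝔪₀ S₀` (`RingEquiv.ofBijective`).

Sources: M. F. Atiyah, I. G. Macdonald, *Introduction to Commutative Algebra* (1969), Ch. 10
(completions as inverse limits `lim A/𝔞ⁿ`, Cor. 10.4; equivalent filtrations give the same
completion; the `(x)`-adic completion of `A[x₁, …, xₙ]` is `A⟦x₁, …, xₙ⟧`, p. 105–106);
W. Fulton, *Introduction to Toric Varieties* (1993), §1.3, §2.1–2.2 (`k[σ^∨ ∩ M]`, simplicial
cones: invariants = degree-`0` part of a polynomial ring graded by a finite abelian group). Tree: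
`ToricTargetPowerSeries.ker_constantCoeff_eq_idealOfVars`, `mem_pow_smul_top_iff`. No new
definitions (the level maps and `Ψ` are built inside proofs), no named facts. [folklore]
-/

noncomputable section

set_option linter.dupNamespace false -- mandated namespace of this single-conjunct summit

open Literature.AlgebraicGeometry.Resolution

namespace Summit.ResolutionOfSingularities.ResolutionOfSingularities.Theorems.TeissierResolve.SupportedSeriesAdicCompletion

attribute [local instance] MvPolynomial.weightedGradedAlgebra

/-! ## Combinatorics of weight-zero exponents -/

/-- If every exponent of `m : Fin d' →₀ ℕ` is at most `N`, its total degree is at most `d' N`.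
[folklore] -/
theorem degree_le_mul_of_forall_le {d' : ℕ} (m : Fin d' →₀ ℕ) (N : ℕ) (h : ∀ j, m j ≤ N) :
    Finsupp.degree m ≤ d' * N := by
  rw [Finsupp.degree_eq_sum]
  calc ∑ j, m j ≤ ∑ _j : Fin d', N := Finset.sum_le_sum fun j _ => h j
    _ = d' * N := by simp

/-- A weight with values in an abelian group `A'` kills the exponent `|A'| • e_j`: its weight is
`|A'| • deg j = 0` (`Nat.card`, which is `0` for infinite `A'`). [folklore] -/
theorem weight_single_card {d' : ℕ} {A' : Type} [AddCommGroup A'] (deg : Fin d' → A')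
    (j : Fin d') : Finsupp.weight deg (Finsupp.single j (Nat.card A')) = 0 := by
  rw [Finsupp.weight_single]
  exact card_nsmul_eq_zero'

/-- A weight-`0` exponent of total degree `≥ d' |A'| + 1` splits off a weight-`0` power
`|A'| • e_j` of a single variable: `m = m' + |A'| • e_j` with `m'` again of weight `0`.
[folklore] -/
theorem exists_split_of_le_degree {d' : ℕ} {A' : Type} [AddCommGroup A'] (deg : Fin d' → A')
    (m : Fin d' →₀ ℕ) (hm : Finsupp.weight deg m = 0)
    (hdeg : d' * Nat.card A' + 1 ≤ Finsupp.degree m) :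
    ∃ (j : Fin d') (m' : Fin d' →₀ ℕ), m = m' + Finsupp.single j (Nat.card A') ∧
      Finsupp.weight deg m' = 0 := by
  obtain ⟨j, hj⟩ : ∃ j, Nat.card A' ≤ m j := by
    by_contra h
    push Not at h
    have hle := degree_le_mul_of_forall_le m (Nat.card A') fun j => (h j).le
    omega
  refine ⟨j, m - Finsupp.single j (Nat.card A'),
    (tsub_add_cancel_of_le (Finsupp.single_le_iff.mpr hj)).symm, ?_⟩
  rwa [← tsub_add_cancel_of_le (Finsupp.single_le_iff.mpr hj), map_add, weight_single_card,
    add_zero] at hm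

/-! ## The graded model: `S₀ ⊆ k[y₁, …, y_{d'}]` and its irrelevant ideal `𝔪₀` -/

set_option hygiene false in
/-- `S₀`: the degree-`0` part of `k[y₁, …, y_{d'}]` for the weights `deg`, as a type (a
commutative ring through the local instance `MvPolynomial.weightedGradedAlgebra`). -/
local notation "S₀" => ↥(MvPolynomial.weightedHomogeneousSubmodule k deg (0 : A'))

set_option hygiene false in
/-- `𝔪₀ = ker (constantCoeff ∘ (S₀ ↪ k[y]))`: the irrelevant ideal of `S₀`. -/
local notation "𝔪₀" => RingHom.ker (MvPolynomial.constantCoeff.comp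
  (algebraMap (MvPolynomial.weightedHomogeneousSubmodule k deg (0 : A'))
    (MvPolynomial (Fin d') k)))

/-- Membership in the irrelevant ideal `𝔪₀` is vanishing of the constant coefficient.
[folklore] -/
theorem mem_irrelevant_iff (k : Type) [Field k] (d' : ℕ) (A' : Type) [AddCommGroup A']
    [DecidableEq A'] (deg : Fin d' → A') (q : S₀) :
    q ∈ 𝔪₀ ↔ MvPolynomial.constantCoeff (q : MvPolynomial (Fin d') k) = 0 :=
  Iff.rfl

/-- `𝔪₀` is the preimage in `S₀` of the ideal of the variables `(y₁, …, y_{d'})`. [folklore] -/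
theorem irrelevant_eq_comap (k : Type) [Field k] (d' : ℕ) (A' : Type) [AddCommGroup A']
    [DecidableEq A'] (deg : Fin d' → A') :
    𝔪₀ = (MvPolynomial.idealOfVars (Fin d') k).comap
      (algebraMap S₀ (MvPolynomial (Fin d') k)) := by
  rw [← ToricTargetPowerSeries.ker_constantCoeff_eq_idealOfVars, RingHom.comap_ker]

/-- Elements of `𝔪₀ ^ n` have no monomials of total degree `< n` (`S₀ ↪ k[y]` maps `𝔪₀ ^ n`
into `(y₁, …, y_{d'}) ^ n`). [folklore] -/
theorem coeff_eq_zero_of_mem_pow (k : Type) [Field k] (d' : ℕ) (A' : Type) [AddCommGroup A']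
    [DecidableEq A'] (deg : Fin d' → A') (n : ℕ) (q : S₀) (hq : q ∈ 𝔪₀ ^ n)
    (x : Fin d' →₀ ℕ) (hx : Finsupp.degree x < n) :
    MvPolynomial.coeff x (q : MvPolynomial (Fin d') k) = 0 := by
  rw [irrelevant_eq_comap] at hq
  exact (MvPolynomial.mem_pow_idealOfVars_iff' n _).mp (Ideal.le_comap_pow _ n hq) x hx

/-- **Key lemma, monomial case.** A weight-`0` monomial `y^m` of total degree
`≥ n (d' |A'| + 1)` lies in `𝔪₀ ^ n`: by induction on `n`, splitting off weight-`0` factors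
`y_j ^ |A'| ∈ 𝔪₀` (`exists_split_of_le_degree`). [folklore] -/
theorem monomial_mem_pow (k : Type) [Field k] (d' : ℕ) (A' : Type) [AddCommGroup A']
    [Finite A'] [DecidableEq A'] (deg : Fin d' → A') (n : ℕ) :
    ∀ (m : Fin d' →₀ ℕ) (hm : MvPolynomial.monomial m (1 : k) ∈
      MvPolynomial.weightedHomogeneousSubmodule k deg (0 : A')),
      Finsupp.weight deg m = 0 → n * (d' * Nat.card A' + 1) ≤ Finsupp.degree m →
      (⟨MvPolynomial.monomial m (1 : k), hm⟩ : S₀) ∈ 𝔪₀ ^ n := by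
  induction n with
  | zero =>
    intro m hm _ _
    rw [pow_zero, Ideal.one_eq_top]
    exact Submodule.mem_top
  | succ n ih =>
    intro m hm hw hdeg
    have hD : d' * Nat.card A' + 1 ≤ Finsupp.degree m :=
      le_trans (Nat.le_mul_of_pos_left _ (Nat.succ_pos n)) hdeg
    obtain ⟨j, m', rfl, hw'⟩ := exists_split_of_le_degree deg m hw hD
    have hN : 0 < Nat.card A' := Nat.card_pos
    have hd' : Nat.card A' ≤ d' * Nat.card A' :=
      Nat.le_mul_of_pos_left _ (Nat.lt_of_le_of_lt (Nat.zero_le _) j.2)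
    have hdeg' : n * (d' * Nat.card A' + 1) ≤ Finsupp.degree m' := by
      rw [map_add, Finsupp.degree_single, Nat.succ_mul] at hdeg
      omega
    have hm' : MvPolynomial.monomial m' (1 : k) ∈
        MvPolynomial.weightedHomogeneousSubmodule k deg (0 : A') :=
      MvPolynomial.isWeightedHomogeneous_monomial deg m' 1 hw'
    have hj : MvPolynomial.monomial (Finsupp.single j (Nat.card A')) (1 : k) ∈
        MvPolynomial.weightedHomogeneousSubmodule k deg (0 : A') :=
      MvPolynomial.isWeightedHomogeneous_monomial deg _ 1 (weight_single_card deg j)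
    -- `y_j ^ |A'| ∈ 𝔪₀` and `y^m = y^{m'} · y_j^{|A'|}` with `y^{m'} ∈ 𝔪₀ ^ n`
    have h2 : (⟨MvPolynomial.monomial (Finsupp.single j (Nat.card A')) (1 : k), hj⟩ : S₀) ∈
        𝔪₀ := by
      rw [mem_irrelevant_iff, MvPolynomial.constantCoeff_monomial, if_neg]
      exact Finsupp.single_ne_zero.mpr hN.ne'
    have hprod : (⟨MvPolynomial.monomial (m' + Finsupp.single j (Nat.card A')) (1 : k), hm⟩ :
        S₀) = ⟨MvPolynomial.monomial m' (1 : k), hm'⟩ *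
          ⟨MvPolynomial.monomial (Finsupp.single j (Nat.card A')) (1 : k), hj⟩ := by
      apply Subtype.ext
      show _ = MvPolynomial.monomial m' (1 : k) * MvPolynomial.monomial _ (1 : k)
      rw [MvPolynomial.monomial_mul, one_mul]
    rw [hprod, pow_succ]
    exact Ideal.mul_mem_mul (ih m' hm' hw' hdeg') h2

/-- **Key lemma** (the `𝔪₀`-adic topology on `S₀` is induced by the `(y)`-adic topology of
`k[y]`): an element of `S₀` without monomials of total degree `< n (d' |A'| + 1)` lies in
`𝔪₀ ^ n` (write it as a `k`-combination of its weight-`0` monomials and apply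
`monomial_mem_pow`). [folklore] -/
theorem mem_pow_of_coeff_eq_zero (k : Type) [Field k] (d' : ℕ) (A' : Type) [AddCommGroup A']
    [Finite A'] [DecidableEq A'] (deg : Fin d' → A') (n : ℕ) (q : S₀)
    (hq : ∀ x : Fin d' →₀ ℕ, Finsupp.degree x < n * (d' * Nat.card A' + 1) →
      MvPolynomial.coeff x (q : MvPolynomial (Fin d') k) = 0) :
    q ∈ 𝔪₀ ^ n := by
  classical
  -- the weight-`0` monomials, as elements of `S₀` (junk value `0` off weight `0`)
  let b : (Fin d' →₀ ℕ) → S₀ := fun m =>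
    if hm : Finsupp.weight deg m = 0 then
      ⟨MvPolynomial.monomial m (1 : k), MvPolynomial.isWeightedHomogeneous_monomial deg m 1 hm⟩
    else 0
  have hw : ∀ m ∈ (q : MvPolynomial (Fin d') k).support, Finsupp.weight deg m = 0 :=
    fun m hm => q.2 (MvPolynomial.mem_support_iff.mp hm)
  have hb : ∀ m ∈ (q : MvPolynomial (Fin d') k).support,
      (b m : MvPolynomial (Fin d') k) = MvPolynomial.monomial m 1 := fun m hm => by
    simp only [b, dif_pos (hw m hm)]
  -- `q = Σ_m coeff_m(q) · y^m` inside `S₀`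
  have hsum : q = ∑ m ∈ (q : MvPolynomial (Fin d') k).support,
      algebraMap k S₀ (MvPolynomial.coeff m (q : MvPolynomial (Fin d') k)) * b m := by
    have hinj : Function.Injective (algebraMap S₀ (MvPolynomial (Fin d') k)) :=
      fun a b h => Subtype.ext h
    apply hinj
    rw [map_sum]
    simp only [map_mul, SetLike.GradeZero.algebraMap_apply, SetLike.GradeZero.coe_algebraMap,
      MvPolynomial.algebraMap_eq]
    conv_lhs => rw [(q : MvPolynomial (Fin d') k).as_sum]
    refine Finset.sum_congr rfl fun m hm => ?_
    rw [hb m hm, MvPolynomial.C_mul_monomial, mul_one]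
  rw [hsum]
  refine Ideal.sum_mem _ fun m hm => Ideal.mul_mem_left _ _ ?_
  have hdeg : n * (d' * Nat.card A' + 1) ≤ Finsupp.degree m :=
    not_lt.mp fun h => MvPolynomial.mem_support_iff.mp hm (hq m h)
  simp only [b, dif_pos (hw m hm)]
  exact monomial_mem_pow k d' A' deg n m _ (hw m hm) hdeg

/-- Two elements of `S₀` with the same monomials of total degree `< n (d' |A'| + 1)` have the
same class in `S₀ ⧸ 𝔪₀ ^ n`. [folklore] -/
theorem mk_eq_mk_of_coeff_eq (k : Type) [Field k] (d' : ℕ) (A' : Type) [AddCommGroup A']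
    [Finite A'] [DecidableEq A'] (deg : Fin d' → A') (n : ℕ) (a b : S₀)
    (h : ∀ x : Fin d' →₀ ℕ, Finsupp.degree x < n * (d' * Nat.card A' + 1) →
      MvPolynomial.coeff x (a : MvPolynomial (Fin d') k) =
        MvPolynomial.coeff x (b : MvPolynomial (Fin d') k)) :
    Ideal.Quotient.mk (𝔪₀ ^ n) a = Ideal.Quotient.mk (𝔪₀ ^ n) b := by
  refine Ideal.Quotient.eq.mpr (mem_pow_of_coeff_eq_zero k d' A' deg n (a - b) fun x hx => ?_)
  rw [← SetLike.GradeZero.algebraMap_apply, map_sub, MvPolynomial.coeff_sub,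
    SetLike.GradeZero.algebraMap_apply, SetLike.GradeZero.algebraMap_apply, h x hx, sub_self]

/-! ## Weight-zero-supported power series and their truncations -/

/-- A total-degree truncation of a power series supported on weight-`0` monomials is a polynomial
of weighted degree `0`, i.e. lies in `S₀`. [folklore] -/
theorem truncTotal_mem (k : Type) [Field k] (d' : ℕ) (A' : Type) [AddCommGroup A']
    (deg : Fin d' → A') (n : ℕ) (f : MvPowerSeries (Fin d') k)
    (hf : ∀ m : Fin d' →₀ ℕ, MvPowerSeries.coeff m f ≠ 0 → Finsupp.weight deg m = 0) :
    MvPowerSeries.truncTotal n f ∈ MvPolynomial.weightedHomogeneousSubmodule k deg (0 : A') := by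
  intro x hx
  by_cases h : Finsupp.degree x < n
  · exact hf x (by rwa [MvPowerSeries.coeff_truncTotal _ h] at hx)
  · exact absurd (MvPowerSeries.coeff_truncTotal_eq_zero _ (not_lt.mp h)) hx

/-- The level-`n` map `R → S₀ ⧸ 𝔪₀ ^ n`, `f ↦ [trunc_{< n (d' |A'| + 1)} f]`, on the subring `R`
of weight-`0`-supported power series is a ring homomorphism: truncation is additive, and unital
and multiplicative up to monomials of total degree `≥` the truncation order, which die in
`𝔪₀ ^ n` (`mk_eq_mk_of_coeff_eq`). [folklore] -/
theorem exists_levelHom (k : Type) [Field k] (d' : ℕ) (A' : Type) [AddCommGroup A'] [Finite A']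
    [DecidableEq A'] (deg : Fin d' → A') (R : Subring (MvPowerSeries (Fin d') k))
    (hR : ∀ f, f ∈ R ↔ ∀ m : Fin d' →₀ ℕ, MvPowerSeries.coeff m f ≠ 0 → Finsupp.weight deg m = 0)
    (n : ℕ) :
    ∃ φ : R →+* S₀ ⧸ 𝔪₀ ^ n, ∀ r : R, φ r = Ideal.Quotient.mk (𝔪₀ ^ n)
      ⟨MvPowerSeries.truncTotal (n * (d' * Nat.card A' + 1)) (r : MvPowerSeries (Fin d') k),
        truncTotal_mem k d' A' deg _ _ ((hR r).mp r.2)⟩ := by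
  -- the truncation `T r ∈ S₀` and its coefficients below the truncation order
  let T : R → S₀ := fun r =>
    ⟨MvPowerSeries.truncTotal (n * (d' * Nat.card A' + 1)) (r : MvPowerSeries (Fin d') k),
      truncTotal_mem k d' A' deg _ _ ((hR r).mp r.2)⟩
  have hTval : ∀ r : R, (T r : MvPolynomial (Fin d') k) =
      MvPowerSeries.truncTotal (n * (d' * Nat.card A' + 1)) (r : MvPowerSeries (Fin d') k) :=
    fun r => rfl
  have hT : ∀ (r : R) (x : Fin d' →₀ ℕ), Finsupp.degree x < n * (d' * Nat.card A' + 1) →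
      MvPolynomial.coeff x (T r : MvPolynomial (Fin d') k) =
        MvPowerSeries.coeff x (r : MvPowerSeries (Fin d') k) :=
    fun r x hx => MvPowerSeries.coeff_truncTotal _ hx
  refine ⟨{ toFun := fun r => Ideal.Quotient.mk (𝔪₀ ^ n) (T r)
            map_one' := ?_
            map_mul' := ?_
            map_zero' := ?_
            map_add' := ?_ }, fun r => rfl⟩
  · -- `[T 1] = 1`
    rw [← map_one (Ideal.Quotient.mk (𝔪₀ ^ n))]
    refine mk_eq_mk_of_coeff_eq k d' A' deg n _ _ fun x hx => ?_
    rw [hT _ x hx, Subring.coe_one, SetLike.GradeZero.coe_one, ← MvPolynomial.coeff_coe,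
      MvPolynomial.coe_one]
  · -- `[T (r s)] = [T r] [T s]`
    intro r s
    show Ideal.Quotient.mk (𝔪₀ ^ n) (T (r * s)) =
      Ideal.Quotient.mk (𝔪₀ ^ n) (T r) * Ideal.Quotient.mk (𝔪₀ ^ n) (T s)
    rw [← map_mul]
    refine mk_eq_mk_of_coeff_eq k d' A' deg n _ _ fun x hx => ?_
    rw [hT _ x hx, Subring.coe_mul, SetLike.GradeZero.coe_mul, hTval, hTval,
      MvPowerSeries.coeff_truncTotal_mul_truncTotal_eq_coeff_mul _ _ hx]
  · -- `[T 0] = 0`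
    show Ideal.Quotient.mk (𝔪₀ ^ n) (T 0) = 0
    rw [← map_zero (Ideal.Quotient.mk (𝔪₀ ^ n))]
    congr 1
    apply Subtype.ext
    rw [hTval, Subring.coe_zero, map_zero]
    rfl
  · -- `[T (r + s)] = [T r] + [T s]`
    intro r s
    show Ideal.Quotient.mk (𝔪₀ ^ n) (T (r + s)) =
      Ideal.Quotient.mk (𝔪₀ ^ n) (T r) + Ideal.Quotient.mk (𝔪₀ ^ n) (T s)
    rw [← map_add]
    congr 1
    apply Subtype.ext
    rw [hTval, Subring.coe_add, map_add]
    rfl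

/-- **The ring of weight-`0`-supported power series is the completed simplicial toric ring**
(stub `stub_supportedSeries_adicCompletion` of line Sketch of `TeissierResolve`). For a field `k`,
a finite abelian group `A'` and weights `deg : Fin d' → A'`, let `S₀ ⊆ k[y₁, …, y_{d'}]` be the
degree-`0` part of the weighted grading and `𝔪₀ = ker (constantCoeff ∘ (S₀ ↪ k[y]))`; then a
subring `R ⊆ k⟦y₁, …, y_{d'}⟧` consisting exactly of the power series supported on weight-`0`
monomials is ring-isomorphic to `AdicCompletion 𝔪₀ S₀`. The isomorphism is
`f ↦ ([trunc_{< n (d' |A'| + 1)} f])_n` (`AdicCompletion.liftRingHom` of the levels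
`exists_levelHom`); it is injective because `𝔪₀ ^ n ⊆ (y) ^ n` sees all coefficients of degree
`< n`, and surjective because an `𝔪₀`-adic Cauchy sequence of weight-`0` polynomials converges
coefficientwise to a weight-`0`-supported series whose truncations are congruent to the sequence,
by the key lemma `mem_pow_of_coeff_eq_zero` (the `𝔪₀`-adic and `(y)`-adic topologies on `S₀`
agree). [folklore] -/
theorem stub_supportedSeries_adicCompletion (k : Type) [Field k] (d' : ℕ) (A' : Type)
    [AddCommGroup A'] [Finite A'] [DecidableEq A'] (deg : Fin d' → A')
    (R : Subring (MvPowerSeries (Fin d') k))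
    (hR : ∀ f, f ∈ R ↔ ∀ m : Fin d' →₀ ℕ, MvPowerSeries.coeff m f ≠ 0 → Finsupp.weight deg m = 0) :
    Nonempty (R ≃+*
      AdicCompletion
        (RingHom.ker (MvPolynomial.constantCoeff.comp
          (algebraMap (MvPolynomial.weightedHomogeneousSubmodule k deg 0)
            (MvPolynomial (Fin d') k))))
        (MvPolynomial.weightedHomogeneousSubmodule k deg 0)) := by
  have hD : 0 < d' * Nat.card A' + 1 := Nat.succ_pos _
  -- the levels `φ n : R → S₀ ⧸ 𝔪₀ ^ n`, `f ↦ [trunc_{< n D} f]`, `D = d' |A'| + 1`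
  choose φ hφ using exists_levelHom k d' A' deg R hR
  -- they are compatible, hence lift to `Ψ : R → AdicCompletion 𝔪₀ S₀`
  have hcompat : ∀ {m n : ℕ} (hle : m ≤ n),
      (Ideal.Quotient.factorPow 𝔪₀ hle).comp (φ n) = φ m := by
    intro m n hle
    refine RingHom.ext fun r => ?_
    rw [RingHom.comp_apply, hφ, hφ, Ideal.Quotient.factorPow, Ideal.Quotient.factor_mk]
    refine mk_eq_mk_of_coeff_eq k d' A' deg m _ _ fun x hx => ?_
    show MvPolynomial.coeff x (MvPowerSeries.truncTotal _ _) =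
      MvPolynomial.coeff x (MvPowerSeries.truncTotal _ _)
    rw [MvPowerSeries.coeff_truncTotal _ hx,
      MvPowerSeries.coeff_truncTotal _ (lt_of_lt_of_le hx (Nat.mul_le_mul_right _ hle))]
  obtain ⟨Ψ, hΨ⟩ : ∃ Ψ : R →+* AdicCompletion 𝔪₀ S₀, ∀ (n : ℕ) (r : R),
      AdicCompletion.evalₐ 𝔪₀ n (Ψ r) = Ideal.Quotient.mk (𝔪₀ ^ n)
        ⟨MvPowerSeries.truncTotal (n * (d' * Nat.card A' + 1)) (r : MvPowerSeries (Fin d') k),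
          truncTotal_mem k d' A' deg _ _ ((hR r).mp r.2)⟩ :=
    ⟨AdicCompletion.liftRingHom 𝔪₀ φ hcompat, fun n r => by
      rw [AdicCompletion.evalₐ_liftRingHom, hφ]⟩
  refine ⟨RingEquiv.ofBijective Ψ ⟨?_, ?_⟩⟩
  · -- injective: `𝔪₀ ^ n` sees every coefficient of degree `< n`
    refine (injective_iff_map_eq_zero _).mpr fun r hr =>
      Subtype.ext (MvPowerSeries.ext fun x => ?_)
    rw [Subring.coe_zero, map_zero]
    have h := hΨ (Finsupp.degree x + 1) r
    rw [hr, map_zero, eq_comm, Ideal.Quotient.eq_zero_iff_mem] at h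
    rw [← coeff_eq_zero_of_mem_pow k d' A' deg _ _ h x (Nat.lt_succ_self _)]
    show _ = MvPolynomial.coeff x (MvPowerSeries.truncTotal _ _)
    rw [MvPowerSeries.coeff_truncTotal]
    exact lt_of_lt_of_le (Nat.lt_succ_self _) (Nat.le_mul_of_pos_right _ hD)
  · -- surjective: a Cauchy sequence of weight-`0` polynomials converges coefficientwise
    intro z
    obtain ⟨c, rfl⟩ := AdicCompletion.mk_surjective 𝔪₀ S₀ z
    have hcauchy : ∀ {m n : ℕ}, m ≤ n → c.val m - c.val n ∈ 𝔪₀ ^ m := fun hmn =>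
      (mem_pow_smul_top_iff _ _ _).mp (SModEq.sub_mem.mp (c.property hmn))
    -- the coefficientwise limit `g ∈ R` of `c`
    obtain ⟨g, hgc⟩ : ∃ g : MvPowerSeries (Fin d') k, ∀ x, MvPowerSeries.coeff x g =
        MvPolynomial.coeff x ((c.val (Finsupp.degree x + 1) : S₀) : MvPolynomial (Fin d') k) :=
      ⟨fun x => MvPolynomial.coeff x
        ((c.val (Finsupp.degree x + 1) : S₀) : MvPolynomial (Fin d') k), fun x => rfl⟩
    have hg : g ∈ R := by
      rw [hR]
      intro x hx
      rw [hgc] at hx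
      exact (c.val (Finsupp.degree x + 1)).2 hx
    refine ⟨⟨g, hg⟩, AdicCompletion.ext_evalₐ fun n => ?_⟩
    -- `trunc_{< n D} g ≡ c_{n D} ≡ c_n (mod 𝔪₀ ^ n)`
    have hle : n ≤ n * (d' * Nat.card A' + 1) := Nat.le_mul_of_pos_right _ hD
    rw [hΨ, AdicCompletion.evalₐ_mk, Ideal.Quotient.eq.mpr (hcauchy hle)]
    refine mk_eq_mk_of_coeff_eq k d' A' deg n _ _ fun x hx => ?_
    show MvPolynomial.coeff x (MvPowerSeries.truncTotal _ g) = _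
    rw [MvPowerSeries.coeff_truncTotal _ hx, hgc]
    have h := coeff_eq_zero_of_mem_pow k d' A' deg _ _ (hcauchy (Nat.succ_le_of_lt hx)) x
      (Nat.lt_succ_self _)
    rw [← SetLike.GradeZero.algebraMap_apply, map_sub, MvPolynomial.coeff_sub, sub_eq_zero,
      SetLike.GradeZero.algebraMap_apply, SetLike.GradeZero.algebraMap_apply] at h
    exact h

end Summit.ResolutionOfSingularities.ResolutionOfSingularities.Theorems.TeissierResolve.SupportedSeriesAdicCompletion

end
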